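import Summits.AtomisticToContinuum.HydrodynamicLimit.Theses.TwoClocks
import Summits.AtomisticToContinuum.HydrodynamicLimit.Theses.ImplosionDichotomy
import Summits.AtomisticToContinuum.HydrodynamicLimit.Theses.OneFlightGossipEngine
import Summits.AtomisticToContinuum.HydrodynamicLimit.Theorems.ImplosionDichotomyHydroLimitInBandOfHeart
import Summits.AtomisticToContinuum.HydrodynamicLimit.Theorems.ImplosionDichotomyHydroLimitInBandWindowContinuity
import Summits.AtomisticToContinuum.HydrodynamicLimit.Theorems.ImplosionDichotomyHydroLimitInBandActivityTailsOfTransfer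
import Summits.AtomisticToContinuum.HydrodynamicLimit.Theorems.OneFlightGossipEngineClampedCurrentsDockWindowContinuity
import Summits.AtomisticToContinuum.HydrodynamicLimit.Theorems.OneFlightGossipEngineAssembly
import HarnessLib

/-!
# `TwoClocks.TransferEntropyClock` from the shared one-window heart and the three family-uniform nodes
# (line `Sketch`, crux stmt-AtomisticToContinuum-16625; support file, `--supports`)

Kernel-checked bookkeeping recording IN THE TREE what the line leads of crux 16625 (`-0`, `c1`, `c2`) established:
the macroscopic clock `TransferEntropyClock = KineticWindowLDUniform → ClampedTransferWindowLD → TransferActivityTails →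
EnergyCurrentTails → DiluteSelfConsistency → _root_.HydrodynamicLimit` follows from

* the SHARED HEART `HydroLimitInBandOfHeart.OneWindowLedger` (Yau's one-window entropy ledger in band; its two clauses
  `HydroLimitInBandHeart.stub_windowClause` / `stub_staticClause` are landed, the 20-line glue lands in the sibling file
  `TwoClocksTransferEntropyClockOneWindowLedger.lean` as soon as the farm has built the window-clause module), and
* EXACTLY the three family-uniform nodes of the route's TWO-LAYER PLAN, typed by their landed in-band copies
  `HydroLimitInBandOfHeart.{KineticCurrentsWindowLDFamily, LocalClampedTransferWindowLDFamily,
  CoherentSuprathermalContentVanishesW}`,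

because the crux's own antecedent `TransferActivityTails` is byte-identical with the dock's
`ClampedCurrentsDockTransferTails.TransferActivityTails` and yields the momentum- and energy-activity tails
(`HydroLimitInBandHeart.activityTails_of_transferActivityTails`), `EnergyCurrentTails` is the OneFlightGossipEngine board
item verbatim (`twoClocks_energyCurrentTails_iff`), the window continuity is landed
(`ClampedCurrentsDockWindowContinuity.stub_windowContinuity`), the landed
`hydroLimitInBand_of_heart` gives `ImplosionDichotomy.HydroLimitInBand`, and since the D-0032 re-type the sub-problem
Statement `_root_.HydrodynamicLimit` IS that packing-guarded limit (same term). The pointwise kinetic node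
`KineticWindowLDUniform`, the global-equilibrium collisional LD `ClampedTransferWindowLD` and `DiluteSelfConsistency` are
idle in this composition: the first two feed only the (conjecture-grade) upgrades to the family nodes, the third became
redundant when the packing guard moved into the Statement.

Nothing here claims mathematical content beyond composition; the three nodes and the heart are where the mathematics is.
Lead prover-line-stmt-AtomisticToContinuum-16625-c2-0, cycle 2.
-/

namespace Summit.AtomisticToContinuum.HydrodynamicLimit.Theorems.TransferEntropyClockFamilyNodes

open Summit.AtomisticToContinuum.HydrodynamicLimit.Theses
open Summit.AtomisticToContinuum.HydrodynamicLimit.Theorems.HydroLimitInBandOfHeart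
  (OneWindowLedger WindowContinuity LineInputs LocalClampedTransferWindowLDFamily CollisionEnergyActivityTails
    CoherentSuprathermalContentVanishesW KineticCurrentsWindowLDFamily hydroLimitInBand_of_heart)

/-- **The crux's tail antecedent is the dock's.** `TwoClocks.TransferActivityTails` (stmt-AtomisticToContinuum-16624) and
`ClampedCurrentsDockTransferTails.TransferActivityTails` are the same term. [folklore] -/
theorem transferActivityTails_iff_dock :
    TwoClocks.TransferActivityTails ↔ ClampedCurrentsDockTransferTails.TransferActivityTails :=
  Iff.rfl

/-- **The energy-activity tails of the heart are the dock's.** `HydroLimitInBandOfHeart.CollisionEnergyActivityTails` and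
`ClampedCurrentsDockTransferTails.CollisionEnergyActivityTails` are the same term. [folklore] -/
theorem collisionEnergyActivityTails_iff_dock :
    CollisionEnergyActivityTails ↔ ClampedCurrentsDockTransferTails.CollisionEnergyActivityTails :=
  Iff.rfl

/-- **Since the D-0032 re-type the sub-problem Statement IS the packing-guarded limit.** `_root_.HydrodynamicLimit` and
`ImplosionDichotomy.HydroLimitInBand` (shared crux stmt-AtomisticToContinuum-9133) are the same term. [folklore] -/
theorem hydrodynamicLimit_iff_hydroLimitInBand :
    _root_.HydrodynamicLimit ↔ ImplosionDichotomy.HydroLimitInBand :=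
  Iff.rfl

/-- **The ledger's input bundle from the three family nodes and the crux's two tail antecedents.** The transfer-activity
tails give CAT and CEAT (`activityTails_of_transferActivityTails`), ECT is the board item by name
(`twoClocks_energyCurrentTails_iff`, landed). [folklore] -/
theorem lineInputs_of_familyNodes (hK : KineticCurrentsWindowLDFamily) (hL : LocalClampedTransferWindowLDFamily)
    (hC : CoherentSuprathermalContentVanishesW) (h₇ : TwoClocks.TransferActivityTails)
    (h₆ : TwoClocks.EnergyCurrentTails) : LineInputs :=
  have hT := HydroLimitInBandHeart.activityTails_of_transferActivityTails (transferActivityTails_iff_dock.mp h₇)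
  ⟨hL, collisionEnergyActivityTails_iff_dock.mpr hT.2, hC, hK, hT.1, twoClocks_energyCurrentTails_iff.mp h₆⟩

/-- **The macroscopic clock from the heart and the three family-uniform nodes** (registered stub
`stub_familyNodesReduction` of line `Sketch`, crux stmt-AtomisticToContinuum-16625, with the heart as a leading hypothesis):
bundle the nodes with the crux's tail antecedents into `LineInputs`, run the landed `hydroLimitInBand_of_heart` with the
landed window continuity (`ClampedCurrentsDockWindowContinuity.stub_windowContinuity`, same term as the heart's `WindowContinuity`),
and read the packing-guarded limit as the Statement. `KineticWindowLDUniform`,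
`ClampedTransferWindowLD` and `DiluteSelfConsistency` are idle. [cite: Yau1991, §2] -/
theorem transferEntropyClock_of_heart_of_familyNodes (hW : OneWindowLedger) (hK : KineticCurrentsWindowLDFamily)
    (hL : LocalClampedTransferWindowLDFamily) (hC : CoherentSuprathermalContentVanishesW) :
    TwoClocks.TransferEntropyClock :=
  fun _ _ h₇ h₆ _ =>
    hydrodynamicLimit_iff_hydroLimitInBand.mpr
      (hydroLimitInBand_of_heart hW ClampedCurrentsDockWindowContinuity.stub_windowContinuity
        (lineInputs_of_familyNodes hK hL hC h₇ h₆))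

/-- **Registered stub `stub_familyNodesReductionOfHeart`** of line `Sketch` (crux stmt-AtomisticToContinuum-16625), the signature spelled
out verbatim: the clock from the heart and the three family-uniform nodes. [cite: Yau1991, §2] -/
theorem stub_familyNodesReductionOfHeart : OneWindowLedger → KineticCurrentsWindowLDFamily → LocalClampedTransferWindowLDFamily → CoherentSuprathermalContentVanishesW → TwoClocks.TransferEntropyClock :=
  transferEntropyClock_of_heart_of_familyNodes

/-- **The route's Assembly frame likewise** (stmt-AtomisticToContinuum-16626 is a weakening of the clock). [cite: Yau1991, §2] -/
theorem assembly_of_heart_of_familyNodes (hW : OneWindowLedger) (hK : KineticCurrentsWindowLDFamily)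
    (hL : LocalClampedTransferWindowLDFamily) (hC : CoherentSuprathermalContentVanishesW) :
    TwoClocks.Assembly :=
  fun hKW h₃ h₆ h₇ _ _ hS => transferEntropyClock_of_heart_of_familyNodes hW hK hL hC hKW h₃ h₇ h₆ hS

end Summit.AtomisticToContinuum.HydrodynamicLimit.Theorems.TransferEntropyClockFamilyNodes
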